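import Summits.QuantumFields.BalabanUV.Beta.GAN24.S3DiffLVertex
import Summits.QuantumFields.BalabanUV.Beta.GAN24.TaylorRowLam
import Summits.QuantumFields.BalabanUV.Beta.GAN24.SandwichDecimateVertex

/-!
# `BalabanUV.Beta.GAN24.S3DiffLAligned` — binder row G-an2-4 / (CONV-C), S-slot, road «S3-Taylor», DIFF row **R3-dL**, part 2 of 3
# (generic `d`): THE DIFFERENCE OF THE TWO ALIGNED Λ PIECES — the three-leg telescoping bound with leaf-18's power count (`≤ K·Q·(Lc^{k+2})⁻¹`,
# `Q = dA·CB′·CΦ + CA·CB′·dΦ + CA·dB·CΦ`), and member `p+1`'s Λ piece ALIGNED onto member `p`'s lattice by leaf-04-g20's «SANDWICH-DECIMATE*»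

NOT IN PRINT; OUR PROOF ATTEMPT.  HONEST FRAMING (cell contract, verbatim): «discharging `BetaPertH` makes Bałaban's UV stability
UNCONDITIONAL — a real constructive-QFT result; it is NOT the continuum limit and NOT the Clay problem.»  HONEST DEPENDENCY (verbatim):
«continuum YM on T⁴ ⇐ BetaPertH ∧ nine spine estimates (0/9 proved); BetaPertH ⇐ (D1) ∧ (D4) ∧ CAP+tail; G-an2-4 gates asym, D1 and
NE2/3/4.»  [folklore] bookkeeping over TREE modules BY NAME (leaf-18's `TaylorRowLam`∕`TaylorRowLamTable` — `piece_eq_pref_mul_sandwich`,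
`power_count`, `table_mass_le`, support boxes; leaf-04-g20's `SandwichDecimate`∕`SandwichDecimateVertex` — `decLeg`, `sandwich_decimate_avgLift_of_legs`,
`abs_decLeg_le`; this lineage's `TaylorDiffLam.lamSandwich_sub_le` ∕ `sandwich_const_mul_vertex` and part 1 `S3DiffLVertex`): 0 `def`, 0 cite,
0 `def … : Prop`, 0 sorry.  Discharges NOTHING of «E3SupRate»∕(hS, hSall) by itself; NOT BetaPertH, NOT continuum, NOT Clay.

## Contents (generic `d`; member `p = ℓ+k+1`, `N = Lc^p`, `M = Lc^ℓ`, `N′ = Lc^{ℓ+1}`, prefactor `pref(p,ℓ) = −(cΛ∕Lc^{d+1})·N^{d−2}·M^{d+3}`)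
§3 `key_count` (the power count with a generic nonnegative leg constant `Q` in place of `CΦ`), **`abs_pref_sandwich_sub_le`** — for ABSTRACT outer
   legs `A, B` (member `p`) ∕ `A′, B′` (member `p+1`, decimated) with their differences (`dA`, `dB`: «(N1-Cauchy)») and the explicit vertex legs
   (`CΦ`, `dΦ`: the K-slot): `|pref·SW(A′,H′,B′) − pref·SW(A,H,B)| ≤ (|cΛ|∕Lc^{d+1})·(d+1)·Q·e^κ·(8(d+1)(Lc+1)+1)^{d+1}·M₀·K_W·K_U·Zl·(Lc^{k+2})⁻¹·
   e^{−(κ∕2)(|x′−u′|₁+|z′−u′|₁)}`, every constant `(ℓ,k)`-FREE.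
§4 `pref_succ_mul` (`pref(p+1,ℓ+1)·Lc^{−(d+1)} = pref(p,ℓ)·Lc^d`), **`piece_succ_eq_pref_mul_sandwich`** — member `p+1`'s Λ piece (level `ℓ+1`
   pushed `k` times) IS `pref(p,ℓ)` times the Λ sandwich on member `p`'s lattice with outer legs `decLeg Lc G̃_{N₊}`, `decLeg Lc H̃_{N₊}` and vertex
   leg `Lc^d·onLat N′ (N₊^{d+2}·𝒬ᵀ_R Φ_{N₊}(·−u′) μ)` (the alignment identity's outer-leg∕Φ hypotheses serve only its absolute convergence).
-/

noncomputable section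

open Finset
open scoped BigOperators
open Literature.MathematicalPhysics.QuantumFieldTheory
open Literature.MathematicalPhysics.QuantumFieldTheory.Balaban1983to89
open Literature.MathematicalPhysics.QuantumFieldTheory.Balaban1983to89.Beta
open Literature.Probability.LatticeModels (Torus.proj Torus.proj_apply)
open AffineAveraging (Site Form1 unitVec unitVec_apply)
open AffineReproduction (contourSumAdj)
open LatticeForm (quo)
open B12Sec2to5 (l1 l1_nonneg)
open ExpKernelCalculus (MKer Zl BiLoc Decays l1_sub_triangle l1_sub_symm l1_natSmul)
open OneStepResolventKernel (Fib KInv LocStencil proj_zsmul quo_zsmul eq_zsmul_quo_of_proj KInv_inr_inr_coarse)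
open OneStepKernelFamily (KInvStep legSet legW legPt)
open KernelSpecInstance (wH wΦ)
open KKTFluctuationKernel (GamΦ)
open InterLevelTransport (SLam avgLift cwsum cwsum_apply onLat onLat_zsmul onLat_off)
open BalabanStepJets (lamCoeffOf)
open BalabanCompositeJets (lagrInc)
open AveragingHessianKernels (hessFF ell)
open Summit.QuantumFields.BalabanUV.Beta.HessKerDressedUnits (unitK unitK_apply legScale_inr)
open Summit.QuantumFields.BalabanUV.Beta.SecondOrderUnits (KInvStep_mm_eq_KInv_mm)
open Summit.QuantumFields.BalabanUV.Beta.GAN24.CombesThomas (SupBound UnitDecayK CauchyDecayK sfStep smStep ConvCKWall)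
open Summit.QuantumFields.BalabanUV.Beta.GAN24.E3UnitSplit (e3OfS e3OfS_inl_inr e3OfS_inr e3Lam_unit_split)
open Summit.QuantumFields.BalabanUV.Beta.GAN24.TaylorLamVertexPairing (quo_quo abs_contourSumAdj_le_exp)
open Summit.QuantumFields.BalabanUV.Beta.GAN24.TaylorBlockSum (nonneg_of_dominated)
open Summit.QuantumFields.BalabanUV.Beta.GAN24.StencilSlotE3PhiLeg (phiLeg_three pow_N_eq)
open Summit.QuantumFields.BalabanUV.Beta.GAN24.TaylorDiffLam (lamSandwich_sub_le sandwich_const_mul_vertex contourSumAdj_sub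
  contourSumAdj_const_mul onLat_sub_apply onLat_const_mul_apply abs_onLat_contourSumAdj_le)
open Summit.QuantumFields.BalabanUV.Beta.GAN24.TaylorRowLam (power_count piece_eq_pref_mul_sandwich inv_pow_succ_succ mul_exp_mono_rate
  table_mass_le mem_boxW_of_ne_zero mem_imageY_of_ne_zero l1_le_of_mem_imageY l1_le_of_mem_box)
open Summit.QuantumFields.BalabanUV.Beta.GAN24.SandwichDecimate (decLeg decLeg_apply sandwich_decimate_avgLift_of_legs abs_decLeg_le abs_decLeg_le')

namespace Summit.QuantumFields.BalabanUV.Beta.GAN24.S3DiffL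

variable {d : ℕ} {Lc : ℕ} [NeZero Lc]

/-! ## §3 The difference of the two ALIGNED Λ sandwiches with their common prefactor: `≤ K·(rates)·(Lc^{k+2})⁻¹` -/

section Main

variable {κ CA CA' CB CB' dA dB CΦ dΦ : ℝ} {x' u' z' : Site (d + 1)} {A A' B B' : Fin (d + 1) → Site (d + 1) → ℝ}

/-- [folklore] THE POWER COUNT with a generic nonnegative leg constant `Q` in place of `CΦ` (leaf-18's `power_count` + the `S_w`-box count):
`N^{d−2}·M^{d+3}·(N^{d+2}·R·Q·N^{−2(d+1)}·e^κ)·MassBox(ℓ) ≤ Q·e^κ·(8(d+1)(Lc+1)+1)^{d+1}·M₀·(Lc^{k+2})⁻¹`. -/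
theorem key_count (ℓ k : ℕ) (κ : ℝ) {Q : ℝ} (hQ : 0 ≤ Q) :
    (((Lc ^ (ℓ + k + 1) : ℕ) : ℝ)) ^ ((d : ℤ) - 2) * ((Lc : ℝ) ^ ℓ) ^ (d + 3) *
      (((((Lc ^ (ℓ + k + 1) : ℕ) : ℝ)) ^ (d + 2) * ((Lc : ℝ) ^ k * ((Q * (((Lc : ℝ) ^ (ℓ + k + 1)) ^ (2 * (d + 1)))⁻¹) * Real.exp κ))) *
          ((((2 * (2 * (2 * (d + 1) * (Lc + 1) * Lc ^ ℓ)) + 1) ^ (d + 1) : ℕ) : ℝ) * (((d : ℝ) + 1) * (((d : ℝ) + 1) *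
            ((((2 * (4 * (d + 1) + 1) + 1) ^ (d + 1) : ℕ) : ℝ) * (2 * (ell (d + 1) Lc : ℝ) ^ 2 / ((Lc : ℝ) ^ ℓ) ^ (2 * (d + 1)))))))) ≤
      (Q * Real.exp κ) * ((((8 * (d + 1) * (Lc + 1) + 1 : ℕ) : ℝ) ^ (d + 1)) * (((d : ℝ) + 1) * (((d : ℝ) + 1) *
      ((((2 * (4 * (d + 1) + 1) + 1) ^ (d + 1) : ℕ) : ℝ) * (2 * (ell (d + 1) Lc : ℝ) ^ 2))))) * ((Lc : ℝ) ^ (k + 2))⁻¹ := by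
  have hL0 : (0 : ℝ) < Lc := by exact_mod_cast Nat.pos_of_ne_zero (NeZero.ne Lc)
  have hL1 : (1 : ℝ) ≤ Lc := by exact_mod_cast (Nat.one_le_iff_ne_zero.2 (NeZero.ne Lc))
  have hcast : (((Lc ^ (ℓ + k + 1) : ℕ) : ℝ)) = (Lc : ℝ) ^ (ℓ + k + 1) := by push_cast; rfl
  have hSw : (((2 * (2 * (2 * (d + 1) * (Lc + 1) * Lc ^ ℓ)) + 1) ^ (d + 1) : ℕ) : ℝ) ≤
      (((8 * (d + 1) * (Lc + 1) + 1 : ℕ) : ℝ) ^ (d + 1)) * ((Lc : ℝ) ^ ℓ) ^ (d + 1) := by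
    rw [← mul_pow]
    push_cast
    refine pow_le_pow_left₀ (by positivity) ?_ _
    have hM1 : (1 : ℝ) ≤ (Lc : ℝ) ^ ℓ := one_le_pow₀ hL1
    nlinarith [hM1, show (0 : ℝ) ≤ 8 * ((d : ℝ) + 1) * (Lc + 1) by positivity]
  have hPC := power_count (d := d) (Lc := Lc) ℓ k
  set M0 : ℝ := ((d : ℝ) + 1) * (((d : ℝ) + 1) *
      ((((2 * (4 * (d + 1) + 1) + 1) ^ (d + 1) : ℕ) : ℝ) * (2 * (ell (d + 1) Lc : ℝ) ^ 2))) with hM0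
  have hM0' : 0 ≤ M0 := by positivity
  set PP : ℝ := ((Lc : ℝ) ^ (ℓ + k + 1)) ^ ((d : ℤ) - 2) * ((Lc : ℝ) ^ ℓ) ^ (d + 3) *
      (((Lc : ℝ) ^ (ℓ + k + 1)) ^ (d + 2) * (Lc : ℝ) ^ k * (((Lc : ℝ) ^ (ℓ + k + 1)) ^ (2 * (d + 1)))⁻¹) *
      (((Lc : ℝ) ^ ℓ) ^ (2 * (d + 1)))⁻¹ with hPP
  have hPP' : 0 ≤ PP := by
    rw [hPP]
    exact mul_nonneg (mul_nonneg (mul_nonneg (zpow_pos (by positivity) _).le (by positivity)) (by positivity)) (by positivity)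
  rw [hcast]
  calc ((Lc : ℝ) ^ (ℓ + k + 1)) ^ ((d : ℤ) - 2) * ((Lc : ℝ) ^ ℓ) ^ (d + 3) *
      ((((Lc : ℝ) ^ (ℓ + k + 1)) ^ (d + 2) * ((Lc : ℝ) ^ k * ((Q * (((Lc : ℝ) ^ (ℓ + k + 1)) ^ (2 * (d + 1)))⁻¹) * Real.exp κ))) *
          ((((2 * (2 * (2 * (d + 1) * (Lc + 1) * Lc ^ ℓ)) + 1) ^ (d + 1) : ℕ) : ℝ) * (((d : ℝ) + 1) * (((d : ℝ) + 1) *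
            ((((2 * (4 * (d + 1) + 1) + 1) ^ (d + 1) : ℕ) : ℝ) * (2 * (ell (d + 1) Lc : ℝ) ^ 2 / ((Lc : ℝ) ^ ℓ) ^ (2 * (d + 1))))))))
        = (Q * Real.exp κ) * M0 * ((((2 * (2 * (2 * (d + 1) * (Lc + 1) * Lc ^ ℓ)) + 1) ^ (d + 1) : ℕ) : ℝ) * PP) := by
          rw [hM0, hPP]; ring
      _ ≤ (Q * Real.exp κ) * M0 * (((((8 * (d + 1) * (Lc + 1) + 1 : ℕ) : ℝ) ^ (d + 1)) * ((Lc : ℝ) ^ ℓ) ^ (d + 1)) * PP) :=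
          mul_le_mul_of_nonneg_left (mul_le_mul_of_nonneg_right hSw hPP') (by positivity)
      _ = (Q * Real.exp κ) * ((((8 * (d + 1) * (Lc + 1) + 1 : ℕ) : ℝ) ^ (d + 1)) * M0) *
          (((Lc : ℝ) ^ (ℓ + k + 1)) ^ ((d : ℤ) - 2) * ((Lc : ℝ) ^ ℓ) ^ (d + 3) *
            (((Lc : ℝ) ^ (ℓ + k + 1)) ^ (d + 2) * (Lc : ℝ) ^ k * (((Lc : ℝ) ^ (ℓ + k + 1)) ^ (2 * (d + 1)))⁻¹) *
            (((Lc : ℝ) ^ ℓ) ^ (d + 1) * (((Lc : ℝ) ^ ℓ) ^ (2 * (d + 1)))⁻¹)) := by rw [hPP]; ring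
      _ = _ := by rw [hPC]

/-- [folklore] **THE DIFFERENCE OF THE TWO ALIGNED Λ PIECES** (member `p = ℓ+k+1` at `N = Lc^p` and member `p+1` read on member `p`'s
lattice, common prefactor `pref = −(cΛ∕Lc^{d+1})·N^{d−2}·M^{d+3}`): the outer legs `A, B` (member `p`), `A′, B′` (member `p+1`, decimated) are
ABSTRACT functions in `sandwich_bound`'s block-`ℓ¹` currency together with their differences (`dA`, `dB` — the located input «(N1-Cauchy)»),
the vertex legs are the explicit contour read-outs of the unit-normalised multiplier legs of the two members (`CΦ`, one-step difference `dΦ`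
— the K-slot's `CauchyDecayK`).  Then `|pref·SW(A′,H′,B′) − pref·SW(A,H,B)| ≤ (|cΛ|∕Lc^{d+1})·(d+1)·(dA·CB′·CΦ + CA·CB′·dΦ + CA·dB·CΦ)·e^κ·
(8(d+1)(Lc+1)+1)^{d+1}·M₀·K_W·K_U·Zl_{d+1}(κ∕2)·(Lc^{k+2})⁻¹·e^{−(κ∕2)(|x′−u′|₁+|z′−u′|₁)}` — every constant `(ℓ,k)`-FREE. -/
theorem abs_pref_sandwich_sub_le (cΛ : ℝ) (ℓ k p : ℕ) (hp : p = ℓ + k + 1) (hκ : 0 < κ) (hCΦ : 0 ≤ CΦ) (hdΦ0 : 0 ≤ dΦ)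
    (hA : ∀ l w, |A l w| ≤ CA * Real.exp (-κ * l1 (x' - quo (Lc ^ p) w)))
    (hB : ∀ l' y, |B l' y| ≤ CB * Real.exp (-κ * l1 (quo (Lc ^ p) y - z')))
    (hA' : ∀ l w, |A' l w| ≤ CA' * Real.exp (-κ * l1 (x' - quo (Lc ^ p) w)))
    (hB' : ∀ l' y, |B' l' y| ≤ CB' * Real.exp (-κ * l1 (quo (Lc ^ p) y - z')))
    (hdA : ∀ l w, |A' l w - A l w| ≤ dA * Real.exp (-κ * l1 (x' - quo (Lc ^ p) w)))
    (hdB : ∀ l' y, |B' l' y - B l' y| ≤ dB * Real.exp (-κ * l1 (quo (Lc ^ p) y - z')))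
    (hΦ : ∀ (κ₁ l : Fin (d + 1)) (y : Site (d + 1)),
      |((Lc : ℝ) ^ p) ^ (2 * (d + 1)) * wΦ (N := Lc ^ p) κ₁ l y| ≤ CΦ * Real.exp (-κ * l1 y))
    (hΦ' : ∀ (κ₁ l : Fin (d + 1)) (y : Site (d + 1)),
      |((Lc : ℝ) ^ (p + 1)) ^ (2 * (d + 1)) * wΦ (N := Lc ^ (p + 1)) κ₁ l y| ≤ CΦ * Real.exp (-κ * l1 y))
    (hdΦ : ∀ (κ₁ l : Fin (d + 1)) (y : Site (d + 1)),
      |((Lc : ℝ) ^ (p + 1)) ^ (2 * (d + 1)) * wΦ (N := Lc ^ (p + 1)) κ₁ l y -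
          ((Lc : ℝ) ^ p) ^ (2 * (d + 1)) * wΦ (N := Lc ^ p) κ₁ l y| ≤ dΦ * Real.exp (-κ * l1 y))
    (κ' : Fin (d + 1)) :
    |(-(cΛ / (Lc : ℝ) ^ (d + 1)) * (((Lc ^ p : ℕ) : ℝ)) ^ ((d : ℤ) - 2) * ((Lc : ℝ) ^ ℓ) ^ (d + 3)) *
        (∑' y : Site (d + 1), ∑ l' : Fin (d + 1),
          (∑' w : Site (d + 1), ∑ l : Fin (d + 1), A' l w *
              ∑ μ : Fin (d + 1), ((((Lc ^ p : ℕ) : ℝ)) ^ (d + 1))⁻¹ * ∑' v : Site (d + 1),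
                ((Lc : ℝ) ^ d * onLat (Lc ^ (ℓ + 1)) (fun Y => (((Lc ^ (p + 1) : ℕ) : ℝ)) ^ (d + 2) *
                    contourSumAdj (Lc ^ k) (fun κ₁ q => wΦ (N := Lc ^ (p + 1)) κ₁ κ' (q - u')) μ Y) v) *
                  onLat (Lc ^ (ℓ + 1)) (fun Y => avgLift (Lc ^ ℓ) (hessFF Lc μ Y)) v w y (Sum.inl l) (Sum.inl l')) * B' l' y) -
      (-(cΛ / (Lc : ℝ) ^ (d + 1)) * (((Lc ^ p : ℕ) : ℝ)) ^ ((d : ℤ) - 2) * ((Lc : ℝ) ^ ℓ) ^ (d + 3)) *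
        (∑' y : Site (d + 1), ∑ l' : Fin (d + 1),
          (∑' w : Site (d + 1), ∑ l : Fin (d + 1), A l w *
              ∑ μ : Fin (d + 1), ((((Lc ^ p : ℕ) : ℝ)) ^ (d + 1))⁻¹ * ∑' v : Site (d + 1),
                onLat (Lc ^ (ℓ + 1)) (fun Y => (((Lc ^ p : ℕ) : ℝ)) ^ (d + 2) *
                    contourSumAdj (Lc ^ k) (fun κ₁ q => wΦ (N := Lc ^ p) κ₁ κ' (q - u')) μ Y) v *
                  onLat (Lc ^ (ℓ + 1)) (fun Y => avgLift (Lc ^ ℓ) (hessFF Lc μ Y)) v w y (Sum.inl l) (Sum.inl l')) * B l' y)| ≤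
      |cΛ| / (Lc : ℝ) ^ (d + 1) *
        (((d : ℝ) + 1) * ((dA * CB' * CΦ + CA * CB' * dΦ + CA * dB * CΦ) * Real.exp κ *
            ((((8 * (d + 1) * (Lc + 1) + 1 : ℕ) : ℝ) ^ (d + 1)) * (((d : ℝ) + 1) * (((d : ℝ) + 1) *
              ((((2 * (4 * (d + 1) + 1) + 1) ^ (d + 1) : ℕ) : ℝ) * (2 * (ell (d + 1) Lc : ℝ) ^ 2))))) *
          (Real.exp (κ * (((d : ℝ) + 1) * (4 * ((d : ℝ) + 1) * (Lc + 1)) + (d + 1))) *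
            Real.exp (κ * (((d : ℝ) + 1) * ((4 * ((d : ℝ) + 1) + 1) + 1) + (d + 1))))) *
          Zl (d + 1) (κ / 2)) *
        ((Lc : ℝ) ^ (k + 2))⁻¹ * Real.exp (-(κ / 2) * (l1 (x' - u') + l1 (z' - u'))) := by
  have hL0 : (0 : ℝ) < Lc := by exact_mod_cast Nat.pos_of_ne_zero (NeZero.ne Lc)
  have hcast : (((Lc ^ p : ℕ) : ℝ)) = (Lc : ℝ) ^ p := by push_cast; rfl
  have hNpos : (0 : ℝ) < ((Lc ^ p : ℕ) : ℝ) := by rw [hcast]; positivity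
  have hCA : 0 ≤ CA := nonneg_of_dominated (Real.exp_pos _) (hA 0 0)
  have hCB' : 0 ≤ CB' := nonneg_of_dominated (Real.exp_pos _) (hB' 0 0)
  have hdA0 : 0 ≤ dA := nonneg_of_dominated (Real.exp_pos _) (hdA 0 0)
  have hdB0 : 0 ≤ dB := nonneg_of_dominated (Real.exp_pos _) (hdB 0 0)
  have hZl : 0 ≤ Zl (d + 1) (κ / 2) := by unfold ExpKernelCalculus.Zl; exact tsum_nonneg fun _ => (Real.exp_pos _).le
  -- the three vertex legs in `sandwich_bound`'s currency
  have hH := fun μ v => abs_vertex_le (d := d) (Lc := Lc) ℓ k p hp hκ.le hCΦ hΦ κ' μ u' v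
  have hH' := fun μ v => abs_vertex_succ_le (d := d) (Lc := Lc) ℓ k p hp hκ.le hCΦ hΦ' κ' μ u' v
  have hdH := fun μ v => abs_vertex_sub_le (d := d) (Lc := Lc) ℓ k p hp hκ.le hdΦ0 hdΦ κ' μ u' v
  have hS := lamSandwich_sub_le (d := d) (Lc := Lc) ℓ k p hp hκ hA hB hH hA' hB' hH' hdA hdB hdH
  rw [← mul_sub, abs_mul]
  refine (mul_le_mul_of_nonneg_left hS (abs_nonneg _)).trans ?_
  have habs : |-(cΛ / (Lc : ℝ) ^ (d + 1)) * (((Lc ^ p : ℕ) : ℝ)) ^ ((d : ℤ) - 2) * ((Lc : ℝ) ^ ℓ) ^ (d + 3)| =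
      |cΛ| / (Lc : ℝ) ^ (d + 1) * ((((Lc ^ p : ℕ) : ℝ)) ^ ((d : ℤ) - 2) * ((Lc : ℝ) ^ ℓ) ^ (d + 3)) := by
    rw [abs_mul, abs_mul, abs_neg, abs_div, abs_of_pos (pow_pos hL0 _), abs_of_pos (zpow_pos hNpos _),
      abs_of_pos (pow_pos (pow_pos hL0 _) _), mul_assoc]
  rw [habs]
  -- the combination of the three leg constants
  set Q : ℝ := dA * CB' * CΦ + CA * CB' * dΦ + CA * dB * CΦ with hQ
  have hQ0 : 0 ≤ Q := by rw [hQ]; positivity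
  have hcomb : dA * CB' * ((((Lc ^ p : ℕ) : ℝ)) ^ (d + 2) * ((Lc : ℝ) ^ k * ((CΦ * (((Lc : ℝ) ^ p) ^ (2 * (d + 1)))⁻¹) * Real.exp κ))) +
        CA * CB' * ((((Lc ^ p : ℕ) : ℝ)) ^ (d + 2) * ((Lc : ℝ) ^ k * ((dΦ * (((Lc : ℝ) ^ p) ^ (2 * (d + 1)))⁻¹) * Real.exp κ))) +
        CA * dB * ((((Lc ^ p : ℕ) : ℝ)) ^ (d + 2) * ((Lc : ℝ) ^ k * ((CΦ * (((Lc : ℝ) ^ p) ^ (2 * (d + 1)))⁻¹) * Real.exp κ))) =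
      (((Lc ^ p : ℕ) : ℝ)) ^ (d + 2) * ((Lc : ℝ) ^ k * ((Q * (((Lc : ℝ) ^ p) ^ (2 * (d + 1)))⁻¹) * Real.exp κ)) := by
    rw [hQ]; ring
  rw [hcomb]
  subst hp
  have key := key_count (d := d) (Lc := Lc) ℓ k κ hQ0
  set M0 : ℝ := ((d : ℝ) + 1) * (((d : ℝ) + 1) *
      ((((2 * (4 * (d + 1) + 1) + 1) ^ (d + 1) : ℕ) : ℝ) * (2 * (ell (d + 1) Lc : ℝ) ^ 2))) with hM0
  set F : ℝ := |cΛ| / (Lc : ℝ) ^ (d + 1) * ((d : ℝ) + 1) *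
      (Real.exp (κ * (((d : ℝ) + 1) * (4 * ((d : ℝ) + 1) * (Lc + 1)) + (d + 1))) *
            Real.exp (κ * (((d : ℝ) + 1) * ((4 * ((d : ℝ) + 1) + 1) + 1) + (d + 1)))) *
      Zl (d + 1) (κ / 2) * Real.exp (-(κ / 2) * (l1 (x' - u') + l1 (z' - u'))) with hF
  have hF0 : 0 ≤ F := by rw [hF]; positivity
  calc |cΛ| / (Lc : ℝ) ^ (d + 1) * ((((Lc ^ (ℓ + k + 1) : ℕ) : ℝ)) ^ ((d : ℤ) - 2) * ((Lc : ℝ) ^ ℓ) ^ (d + 3)) *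
      (((d : ℝ) + 1) * ((((Lc ^ (ℓ + k + 1) : ℕ) : ℝ)) ^ (d + 2) * ((Lc : ℝ) ^ k * ((Q * (((Lc : ℝ) ^ (ℓ + k + 1)) ^ (2 * (d + 1)))⁻¹) * Real.exp κ)) *
          ((((2 * (2 * (2 * (d + 1) * (Lc + 1) * Lc ^ ℓ)) + 1) ^ (d + 1) : ℕ) : ℝ) * (((d : ℝ) + 1) * (((d : ℝ) + 1) *
            ((((2 * (4 * (d + 1) + 1) + 1) ^ (d + 1) : ℕ) : ℝ) * (2 * (ell (d + 1) Lc : ℝ) ^ 2 / ((Lc : ℝ) ^ ℓ) ^ (2 * (d + 1))))))) *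
          (Real.exp (κ * (((d : ℝ) + 1) * (4 * ((d : ℝ) + 1) * (Lc + 1)) + (d + 1))) *
            Real.exp (κ * (((d : ℝ) + 1) * ((4 * ((d : ℝ) + 1) + 1) + 1) + (d + 1))))) *
        Zl (d + 1) (κ / 2) * Real.exp (-(κ / 2) * (l1 (x' - u') + l1 (z' - u'))))
      = F * ((((Lc ^ (ℓ + k + 1) : ℕ) : ℝ)) ^ ((d : ℤ) - 2) * ((Lc : ℝ) ^ ℓ) ^ (d + 3) *
      (((((Lc ^ (ℓ + k + 1) : ℕ) : ℝ)) ^ (d + 2) * ((Lc : ℝ) ^ k * ((Q * (((Lc : ℝ) ^ (ℓ + k + 1)) ^ (2 * (d + 1)))⁻¹) * Real.exp κ))) *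
          ((((2 * (2 * (2 * (d + 1) * (Lc + 1) * Lc ^ ℓ)) + 1) ^ (d + 1) : ℕ) : ℝ) * (((d : ℝ) + 1) * (((d : ℝ) + 1) *
            ((((2 * (4 * (d + 1) + 1) + 1) ^ (d + 1) : ℕ) : ℝ) * (2 * (ell (d + 1) Lc : ℝ) ^ 2 / ((Lc : ℝ) ^ ℓ) ^ (2 * (d + 1))))))))) := by
        rw [hF]; ring
    _ ≤ F * ((Q * Real.exp κ) * ((((8 * (d + 1) * (Lc + 1) + 1 : ℕ) : ℝ) ^ (d + 1)) * M0) * ((Lc : ℝ) ^ (k + 2))⁻¹) :=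
        mul_le_mul_of_nonneg_left key hF0
    _ = _ := by rw [hF, hM0]; ring

end Main


/-! ## §4 Member `p+1`'s Λ piece ALIGNED onto member `p`'s lattice («SANDWICH-DECIMATE*», leaf-04-g20, BY NAME) -/

section Aligned

variable {κ CA CB CΦ : ℝ}

/-- [folklore] The prefactor alignment: `pref(p+1, ℓ+1)·Lc^{−(d+1)} = pref(p, ℓ)·Lc^{d}` (`(d−2) + (d+3) − (d+1) = d`). -/
theorem pref_succ_mul (cΛ : ℝ) (ℓ p : ℕ) :
    (-(cΛ / (Lc : ℝ) ^ (d + 1)) * (((Lc ^ (p + 1) : ℕ) : ℝ)) ^ ((d : ℤ) - 2) * ((Lc : ℝ) ^ (ℓ + 1)) ^ (d + 3)) *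
        (((Lc : ℝ)) ^ (d + 1))⁻¹ =
      (-(cΛ / (Lc : ℝ) ^ (d + 1)) * (((Lc ^ p : ℕ) : ℝ)) ^ ((d : ℤ) - 2) * ((Lc : ℝ) ^ ℓ) ^ (d + 3)) * (Lc : ℝ) ^ d := by
  have hL : (Lc : ℝ) ≠ 0 := by exact_mod_cast NeZero.ne Lc
  have hNp : (((Lc ^ p : ℕ) : ℝ)) ≠ 0 := by rw [Nat.cast_pow]; exact pow_ne_zero _ hL
  have hNq : (((Lc ^ (p + 1) : ℕ) : ℝ)) ≠ 0 := by rw [Nat.cast_pow]; exact pow_ne_zero _ hL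
  have hz1 : (((Lc ^ (p + 1) : ℕ) : ℝ)) ^ ((d : ℤ) - 2) = (((Lc ^ (p + 1) : ℕ) : ℝ)) ^ d / (((Lc ^ (p + 1) : ℕ) : ℝ)) ^ 2 := by
    rw [zpow_sub₀ hNq, zpow_natCast, zpow_ofNat]
  have hz2 : (((Lc ^ p : ℕ) : ℝ)) ^ ((d : ℤ) - 2) = (((Lc ^ p : ℕ) : ℝ)) ^ d / (((Lc ^ p : ℕ) : ℝ)) ^ 2 := by
    rw [zpow_sub₀ hNp, zpow_natCast, zpow_ofNat]
  rw [hz1, hz2, Nat.cast_pow, Nat.cast_pow]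
  field_simp
  ring

/-- [folklore] **MEMBER `p+1`'s Λ PIECE, ALIGNED** (level `ℓ+1` pushed `k` times, blocking `N₊ = Lc^{p+1}`): leaf-18's
`piece_eq_pref_mul_sandwich` at `(ℓ+1, k, p+1)` followed by leaf-04-g20's «SANDWICH-DECIMATE*» (`sandwich_decimate_avgLift_of_legs`, the lift
`avgLift (Lc^{ℓ+1}) = avgLift Lc ∘ avgLift (Lc^ℓ)` read against the `Lc`-DECIMATED outer legs `decLeg Lc`) and the prefactor alignment
`pref_succ_mul` pushed into the vertex leg (`TaylorDiffLam.sandwich_const_mul_vertex`): the piece is member `p`'s prefactor times a sandwich on member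
`p`'s lattice with table `onLat (Lc^{ℓ+1}) (avgLift (Lc^ℓ) ∘ hessFF Lc μ)`, outer legs `decLeg Lc G̃_{N₊}`, `decLeg Lc H̃_{N₊}` and vertex leg
`Lc^d · onLat (Lc^{ℓ+1}) (N₊^{d+2}·𝒬ᵀ_{Lc^k} Φ_{N₊}(·−u′) μ)`.  (The outer-leg and Φ bounds are used only for the absolute convergence inside the
alignment identity.) -/
theorem piece_succ_eq_pref_mul_sandwich (cΛ : ℝ) (ℓ k p : ℕ) (hp : p = ℓ + k + 1) (hκ : 0 < κ) (hCΦ : 0 ≤ CΦ)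
    (hA : ∀ (α l : Fin (d + 1)) (x' w : Site (d + 1)),
      |((Lc : ℝ) ^ (p + 1)) ^ (d + 2) * GamΦ (N := Lc ^ (p + 1)) α x' l w| ≤
        CA * Real.exp (-κ * l1 (x' - quo (Lc ^ (p + 1)) w)))
    (hB : ∀ (κ₁ l : Fin (d + 1)) (z : Site (d + 1)),
      |((Lc : ℝ) ^ (p + 1)) ^ (d + 2) * wH (N := Lc ^ (p + 1)) κ₁ l z| ≤ CB * Real.exp (-κ * l1 (quo (Lc ^ (p + 1)) z)))
    (hΦ : ∀ (κ₁ l : Fin (d + 1)) (y : Site (d + 1)),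
      |((Lc : ℝ) ^ (p + 1)) ^ (2 * (d + 1)) * wΦ (N := Lc ^ (p + 1)) κ₁ l y| ≤ CΦ * Real.exp (-κ * l1 y))
    (κ' : Fin (d + 1)) (u' x' z' : Site (d + 1)) (α β : Fin (d + 1)) :
    ((Lc : ℝ) ^ (p + 1)) ^ (2 * (d + 1)) *
        e3OfS (Lc ^ (p + 1)) (fun κ u => (((Lc : ℝ) ^ (d + 1)) ^ k * (cΛ * ((Lc : ℝ) ^ (ℓ + 1)) ^ (2 * d + 4))) •
          lagrInc d Lc (Lc ^ (ℓ + 1)) (Lc ^ (ℓ + 1 + 1)) κ u) κ' u' x' z' (Sum.inl α) (Sum.inl β) =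
      (-(cΛ / (Lc : ℝ) ^ (d + 1)) * (((Lc ^ p : ℕ) : ℝ)) ^ ((d : ℤ) - 2) * ((Lc : ℝ) ^ ℓ) ^ (d + 3)) *
        ∑' y : Site (d + 1), ∑ l' : Fin (d + 1),
          (∑' w : Site (d + 1), ∑ l : Fin (d + 1),
              decLeg Lc (fun l w => (((Lc ^ (p + 1) : ℕ) : ℝ)) ^ (d + 2) * GamΦ (N := Lc ^ (p + 1)) α x' l w) l w *
              ∑ μ : Fin (d + 1), ((((Lc ^ p : ℕ) : ℝ)) ^ (d + 1))⁻¹ * ∑' v : Site (d + 1),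
                ((Lc : ℝ) ^ d * onLat (Lc ^ (ℓ + 1)) (fun Y => (((Lc ^ (p + 1) : ℕ) : ℝ)) ^ (d + 2) *
                    contourSumAdj (Lc ^ k) (fun κ₁ q => wΦ (N := Lc ^ (p + 1)) κ₁ κ' (q - u')) μ Y) v) *
                  onLat (Lc ^ (ℓ + 1)) (fun Y => avgLift (Lc ^ ℓ) (hessFF Lc μ Y)) v w y (Sum.inl l) (Sum.inl l')) *
            decLeg Lc (fun l' y => (((Lc ^ (p + 1) : ℕ) : ℝ)) ^ (d + 2) *
              wH (N := Lc ^ (p + 1)) l' β (y - ((Lc ^ (p + 1) : ℕ) : ℤ) • z')) l' y := by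
  have hL0 : (0 : ℝ) < Lc := by exact_mod_cast Nat.pos_of_ne_zero (NeZero.ne Lc)
  have hL1 : (1 : ℝ) ≤ Lc := by exact_mod_cast (Nat.one_le_iff_ne_zero.2 (NeZero.ne Lc))
  haveI hN0 : NeZero (Lc ^ p) := ⟨pow_ne_zero _ (NeZero.ne Lc)⟩
  haveI hNq0 : NeZero (Lc ^ (p + 1)) := ⟨pow_ne_zero _ (NeZero.ne Lc)⟩
  haveI hNp0 : NeZero (Lc ^ (ℓ + 1)) := ⟨pow_ne_zero _ (NeZero.ne Lc)⟩
  haveI hNp1 : NeZero (Lc ^ (ℓ + 1 + 1)) := ⟨pow_ne_zero _ (NeZero.ne Lc)⟩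
  haveI hM0 : NeZero (Lc ^ ℓ) := ⟨pow_ne_zero _ (NeZero.ne Lc)⟩
  have hNp : Lc ^ (ℓ + 1) = Lc ^ ℓ * Lc := pow_succ Lc ℓ
  have hcastq : (((Lc ^ (p + 1) : ℕ) : ℝ)) = (Lc : ℝ) ^ (p + 1) := by push_cast; rfl
  have hcast : (((Lc ^ p : ℕ) : ℝ)) = (Lc : ℝ) ^ p := by push_cast; rfl
  have hcastP : (((Lc ^ (ℓ + 1) : ℕ) : ℝ)) = (Lc : ℝ) ^ (ℓ + 1) := by push_cast; rfl
  have hcastM : (((Lc ^ ℓ : ℕ) : ℝ)) = (Lc : ℝ) ^ ℓ := by push_cast; rfl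
  -- step 1: leaf-18's unit split + inner identity for member `p+1`
  rw [piece_eq_pref_mul_sandwich cΛ (ℓ + 1) k (p + 1) (by omega) κ' u' x' z' α β]
  -- step 2: the alignment identity (leaf-04-g20), with its hypotheses
  set RWn : ℕ := 2 * (2 * (d + 1) * (Lc + 1) * Lc ^ ℓ) with hRWn
  set RW : ℝ := ((d : ℝ) + 1) * (4 * ((d : ℝ) + 1) * (Lc + 1)) * ((Lc ^ p : ℕ) : ℝ) with hRW
  set RU : ℝ := ((d : ℝ) + 1) * ((4 * ((d : ℝ) + 1) + 1) + 1) * ((Lc ^ p : ℕ) : ℝ) with hRU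
  have hA' : ∀ (l : Fin (d + 1)) (w : Site (d + 1)),
      |((Lc ^ (p + 1) : ℕ) : ℝ) ^ (d + 2) * GamΦ (N := Lc ^ (p + 1)) α x' l w| ≤
        CA * Real.exp (-κ * l1 (x' - quo (Lc ^ (p + 1)) w)) := fun l w => by
    rw [hcastq]; exact hA α l x' w
  have hB' : ∀ (l' : Fin (d + 1)) (y : Site (d + 1)),
      |((Lc ^ (p + 1) : ℕ) : ℝ) ^ (d + 2) * wH (N := Lc ^ (p + 1)) l' β (y - ((Lc ^ (p + 1) : ℕ) : ℤ) • z')| ≤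
        CB * Real.exp (-κ * l1 (quo (Lc ^ (p + 1)) y - z')) := fun l' y => by
    have hq : quo (Lc ^ (p + 1)) (y - ((Lc ^ (p + 1) : ℕ) : ℤ) • z') = quo (Lc ^ (p + 1)) y - z' := by
      rw [sub_eq_add_neg y, ← smul_neg, BlochFibreUniqueness.quo_add_zsmul, ← sub_eq_add_neg]
    rw [hcastq, ← hq]
    exact hB l' β _
  have hH' := fun μ v => abs_vertex_succ_raw_le (d := d) (Lc := Lc) ℓ k p hp hκ.le hCΦ hΦ κ' μ u' v
  have hSD := sandwich_decimate_avgLift_of_legs Lc (Lc ^ p) (Lc ^ (p + 1)) (Lc ^ (ℓ + 1)) (Lc ^ (ℓ + 1 + 1)) (Lc ^ ℓ) (Lc ^ (ℓ + 1))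
    (pow_succ' Lc p) (pow_succ' Lc ℓ) (RW := RW) (RU := RU)
    (A := fun l w => (((Lc ^ (p + 1) : ℕ) : ℝ)) ^ (d + 2) * GamΦ (N := Lc ^ (p + 1)) α x' l w)
    (B := fun l' y => (((Lc ^ (p + 1) : ℕ) : ℝ)) ^ (d + 2) * wH (N := Lc ^ (p + 1)) l' β (y - ((Lc ^ (p + 1) : ℕ) : ℤ) • z'))
    (ψ := fun μ Y => (((Lc ^ (p + 1) : ℕ) : ℝ)) ^ (d + 2) * contourSumAdj (Lc ^ k) (fun κ₁ q => wΦ (N := Lc ^ (p + 1)) κ₁ κ' (q - u')) μ Y)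
    (K := fun μ Y => hessFF Lc μ Y)
    (Sw := fun y => Fintype.piFinset fun j => Finset.Icc (y j - RWn) (y j + RWn))
    (Su := fun y => (Fintype.piFinset fun j =>
        Finset.Icc (quo (Lc ^ (ℓ + 1)) y j - (4 * (d + 1) + 1 : ℕ)) (quo (Lc ^ (ℓ + 1)) y j + (4 * (d + 1) + 1 : ℕ))).image
      (fun Y : Site (d + 1) => ((Lc ^ (ℓ + 1) : ℕ) : ℤ) • Y))
    hκ hA' hB' hH'
    (fun μ v w l y l' hne => mem_boxW_of_ne_zero (Lc := Lc) (Lc ^ (ℓ + 1)) (Lc ^ ℓ) hne)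
    (fun μ v w l y l' hne => mem_imageY_of_ne_zero (Lc := Lc) (Lc ^ (ℓ + 1)) (Lc ^ ℓ) hNp hne)
    (fun y w hw => by
      have h := l1_le_of_mem_box hw
      have hle : ((d : ℝ) + 1) * RWn ≤ RW := by
        rw [hRW, hRWn, hcast]
        push_cast
        have hmono : ((Lc : ℝ) ^ ℓ) ≤ (Lc : ℝ) ^ p := pow_le_pow_right₀ hL1 (by omega)
        nlinarith [hmono, show (0 : ℝ) ≤ ((d : ℝ) + 1) * (4 * ((d : ℝ) + 1) * (Lc + 1)) by positivity]
      exact h.trans hle)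
    (fun y v hv => by
      have h := l1_le_of_mem_imageY (d := d) (Lc ^ (ℓ + 1)) hv
      have hle : ((d : ℝ) + 1) * ((Lc ^ (ℓ + 1) : ℕ) : ℝ) * ((4 * (d + 1) + 1 : ℕ) + 1) ≤ RU := by
        rw [hRU, hcastP, hcast]
        push_cast
        have hmono : ((Lc : ℝ) ^ (ℓ + 1)) ≤ (Lc : ℝ) ^ p := pow_le_pow_right₀ hL1 (by omega)
        nlinarith [hmono, show (0 : ℝ) ≤ ((d : ℝ) + 1) * ((4 * ((d : ℝ) + 1) + 1) + 1) by positivity]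
      exact h.trans hle)
    (fun y l' => table_mass_le (Lc := Lc) (Lc ^ (ℓ + 1)) (Lc ^ ℓ) y l' RWn)
  rw [hSD, ← mul_assoc, pref_succ_mul, mul_assoc, ← sandwich_const_mul_vertex]

end Aligned

end Summit.QuantumFields.BalabanUV.Beta.GAN24.S3DiffL
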